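import Mathlib.MeasureTheory.Integral.IntervalIntegral.Basic
import Summits.RiemannHypothesis.RiemannHypothesis.Theorems.OddSectorOddBartaFloorDefs
import Literature.NumberTheory.LFunctions.WeilMellinBounds
import HarnessLib

/-!
# The polar part of the window image of the truncated odd tail
(crux OddBartaFloor, line Sketch, stub tailPolar)

Let `R = R_{a,b} = oddThetaTailTrunc a b = H_b − H_a` (`0 < a ≤ b`) be the truncated odd tail of the
odd theta vector, `R(s) = −Φ′(s)` for `a < |s| ≤ b` and `0` elsewhere, and let
`ϖ_{a,b} = oddThetaPolarWeightTrunc a b = ∫_{a < s ≤ b} (−Φ′(s))·2 sinh(s/2) ds` be its polar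
weight. For a Weil test `g`, the polar term of the kernel `k = g ⋆ R̃` is

  `k̂(0) + k̂(1) = −2ϖ_{a,b} ∫ g(t) sinh(t/2) dt`.

Proof. `R` is real and odd, so `R̃ = −R` and `k̂(s) = −ĝ(s)R̂(s)` (Mellin multiplicativity by
Fubini, `MeasureTheory.integral_convolution`, as in `weilMellin_weilConv_holds`). For a continuous
weight `w`, `∫ R w = ∫_{−b}^{b} (−Φ′)w − ∫_{−a}^{a} (−Φ′)w = ∫_a^b (−Φ′(x))(w(x) − w(−x)) dx`
(reflect `[−b, −a]` onto `[a, b]`, `Φ′` odd), whence `R̂(1) = ∫ R e^{t/2} = ϖ_{a,b}` and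
`R̂(0) = ∫ R e^{−t/2} = −ϖ_{a,b}`; finally `ĝ(0) − ĝ(1) = ∫ g (e^{−t/2} − e^{t/2}) = −2∫ g sinh(t/2)`.
Sources: E. Bombieri, Rend. Lincei (9) 11 (2000), §2 Thm. 2 (polar term `ĝ(0) + ĝ(1)`) and §3
(transform of a convolution); elementary calculus otherwise.
-/

set_option linter.dupNamespace false

noncomputable section

open Set MeasureTheory Filter Complex
open scoped Real Topology ComplexConjugate ArithmeticFunction.vonMangoldt ENNReal

namespace Summit.RiemannHypothesis.RiemannHypothesis.Theorems.OddBartaFloor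

open Literature.NumberTheory.LFunctions

/-- `(g ⋆ P)^(s) = ĝ(s)·P̂(s)` for `g` continuous of compact support and a second factor `P` with
`P(u)e^{(s−½)u}` integrable (`MeasureTheory.integral_convolution`; Bombieri 2000 §3). [folklore] -/
private theorem tailPolar_mellin_conv {g P : ℝ → ℂ} (hg : Continuous g)
    (hg' : HasCompactSupport g) (s : ℂ)
    (hHi : Integrable fun u : ℝ => P u * cexp ((s - 1 / 2) * u)) :
    weilMellin (weilConv g P) s = weilMellin g s * weilMellin P s := by
  -- adapted from `weilMellin_weilConv_holds` (Literature/…/WeilExplicitProofs.lean)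
  unfold weilMellin
  set c : ℂ := s - 1 / 2 with hc
  set G : ℝ → ℂ := fun u ↦ g u * cexp (c * u) with hG
  set H : ℝ → ℂ := fun u ↦ P u * cexp (c * u) with hH
  have hGi : Integrable G :=
    (hg.mul (by fun_prop)).integrable_of_hasCompactSupport hg'.mul_right
  have key : ∀ t : ℝ, weilConv g P t * cexp (c * t) =
      convolution G H (ContinuousLinearMap.mul ℂ ℂ) volume t := by
    intro t
    rw [weilConv_apply, convolution_def, ← integral_mul_const]
    congr 1 with u
    simp only [hG, hH, ContinuousLinearMap.mul_apply']
    have he : cexp (c * t) = cexp (c * u) * cexp (c * ((t - u : ℝ) : ℂ)) := by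
      rw [← Complex.exp_add]
      push_cast
      ring_nf
    rw [he]
    ring
  have hL : (∫ t : ℝ, weilConv g P t * cexp (c * t)) =
      ∫ t : ℝ, convolution G H (ContinuousLinearMap.mul ℂ ℂ) volume t :=
    integral_congr_ae (Eventually.of_forall fun t ↦ key t)
  rw [hL, integral_convolution (ContinuousLinearMap.mul ℂ ℂ) hGi hHi, ContinuousLinearMap.mul_apply']

/-- `∫ H_c w = ∫_{−c}^{c} (−Φ′) w` for a continuous weight `w` and `0 ≤ c`. [folklore] -/
private theorem tailPolar_integral_vector_mul {c : ℝ} (hc : 0 ≤ c) {w : ℝ → ℝ} :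
    ∫ t, weilOddThetaVector c t * w t = ∫ x in -c..c, -weilThetaPhiDeriv x * w x := by
  have h : (fun t => weilOddThetaVector c t * w t) =
      (Icc (-c) c).indicator (fun t => -weilThetaPhiDeriv t * w t) :=
    funext fun t => (indicator_mul_left (Icc (-c) c) (fun t => -weilThetaPhiDeriv t) w).symm
  rw [h, integral_indicator measurableSet_Icc, integral_Icc_eq_integral_Ioc,
    intervalIntegral.integral_of_le (by linarith)]

/-- `H_c · w` is integrable for a continuous weight `w`. [folklore] -/
private theorem tailPolar_integrable_vector_mul (c : ℝ) {w : ℝ → ℝ} (hw : Continuous w) :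
    Integrable fun t => weilOddThetaVector c t * w t := by
  have h : (fun t => weilOddThetaVector c t * w t) =
      (Icc (-c) c).indicator (fun t => -weilThetaPhiDeriv t * w t) :=
    funext fun t => (indicator_mul_left (Icc (-c) c) (fun t => -weilThetaPhiDeriv t) w).symm
  rw [h, integrable_indicator_iff measurableSet_Icc]
  exact (by fun_prop : Continuous fun t => -weilThetaPhiDeriv t * w t).continuousOn.integrableOn_compact
    isCompact_Icc

/-- The reflection formula `∫ R_{a,b} w = ∫_{a < x ≤ b} (−Φ′(x))(w(x) − w(−x)) dx` for a continuous
weight `w` and `0 ≤ a ≤ b` (`Φ′` is odd). [folklore] -/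
private theorem tailPolar_integral_trunc_mul {a b : ℝ} (ha : 0 ≤ a) (hab : a ≤ b) {w : ℝ → ℝ}
    (hw : Continuous w) :
    ∫ t, oddThetaTailTrunc a b t * w t =
      ∫ x in Ioc a b, -weilThetaPhiDeriv x * (w x - w (-x)) := by
  have hF : Continuous fun x => -weilThetaPhiDeriv x * w x := by fun_prop
  simp only [oddThetaTailTrunc_def, sub_mul]
  rw [integral_sub (tailPolar_integrable_vector_mul b hw) (tailPolar_integrable_vector_mul a hw),
    tailPolar_integral_vector_mul (ha.trans hab), tailPolar_integral_vector_mul ha,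
    intervalIntegral.integral_interval_sub_interval_comm (hF.intervalIntegrable _ _)
      (hF.intervalIntegrable _ _) (hF.intervalIntegrable _ _),
    intervalIntegral.integral_symm a b, sub_neg_eq_add, ← intervalIntegral.integral_comp_neg,
    ← intervalIntegral.integral_add
      ((by fun_prop : Continuous fun x => -weilThetaPhiDeriv (-x) * w (-x)).intervalIntegrable _ _)
      (hF.intervalIntegrable _ _), intervalIntegral.integral_of_le hab]
  refine setIntegral_congr_fun measurableSet_Ioc fun x _ => ?_
  rw [weilThetaPhiDeriv_neg]
  ring

/-- The weighted odd theta vector `H_c(u) e^{zu}` is integrable. [folklore] -/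
private theorem tailPolar_integrable_vector_mul_cexp (c : ℝ) (z : ℂ) :
    Integrable fun u : ℝ => ((weilOddThetaVector c u : ℝ) : ℂ) * cexp (z * u) := by
  refine IntegrableOn.integrable_of_forall_notMem_eq_zero (s := Icc (-c) c) ?_ fun u hu => by
    rw [weilOddThetaVector_of_not_mem hu, Complex.ofReal_zero, zero_mul]
  have hcont : Continuous fun u : ℝ => ((-weilThetaPhiDeriv u : ℝ) : ℂ) * cexp (z * u) := by
    fun_prop
  exact (hcont.continuousOn.integrableOn_compact isCompact_Icc).congr_fun
    (fun u hu => by rw [weilOddThetaVector_of_mem hu]) measurableSet_Icc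

/-- **Polar part of the window computation.** For `0 < a ≤ b` and a Weil test `g`, the polar term
of `k = g ⋆ R̃_{a,b}` is `k̂(0) + k̂(1) = −2ϖ_{a,b} ∫ g(t) sinh(t/2) dt` (Bombieri 2000 §2 Thm. 2,
§3; see the module docstring). [folklore] -/
theorem stub_tailPolar :
    ∀ (a b : ℝ) (g : ℝ → ℂ), 0 < a → a ≤ b → IsWeilTest g → tsupport g ⊆ Icc (-a) a →
      weilPolarTerm (weilConv g (weilReflect fun t => ((oddThetaTailTrunc a b t : ℝ) : ℂ))) =
        -(2 * (oddThetaPolarWeightTrunc a b : ℂ) * ∫ t, g t * (Real.sinh (t / 2) : ℂ)) := by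
  intro a b g ha hab hg _
  -- `R` is real and odd, so `R̃ = -R`
  have hrefl : weilReflect (fun t => ((oddThetaTailTrunc a b t : ℝ) : ℂ)) =
      fun t => -((oddThetaTailTrunc a b t : ℝ) : ℂ) := by
    funext t
    simp only [weilReflect, Complex.conj_ofReal, oddThetaTailTrunc_def, weilOddThetaVector_neg]
    push_cast
    ring
  -- the weighted tail is integrable
  have hint : ∀ z : ℂ,
      Integrable fun u : ℝ => -((oddThetaTailTrunc a b u : ℝ) : ℂ) * cexp (z * u) := by
    intro z
    refine ((tailPolar_integrable_vector_mul_cexp b z).sub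
      (tailPolar_integrable_vector_mul_cexp a z)).neg.congr (Eventually.of_forall fun u => ?_)
    simp only [Pi.neg_apply, Pi.sub_apply, oddThetaTailTrunc_def]
    push_cast
    ring
  -- `k̂(s) = -ĝ(s) R̂(s)`
  have hM : ∀ s : ℂ,
      weilMellin (weilConv g (weilReflect fun t => ((oddThetaTailTrunc a b t : ℝ) : ℂ))) s =
        -(weilMellin g s * weilMellin (fun t => ((oddThetaTailTrunc a b t : ℝ) : ℂ)) s) := by
    intro s
    rw [hrefl, tailPolar_mellin_conv hg.1.continuous hg.2 s (hint _)]
    simp only [weilMellin, neg_mul, integral_neg, mul_neg]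
  -- `R̂` at a real point `r + 1/2` is a real integral
  have hR : ∀ r : ℝ, weilMellin (fun t => ((oddThetaTailTrunc a b t : ℝ) : ℂ)) ((r : ℂ) + 1 / 2) =
      ((∫ x in Ioc a b, -weilThetaPhiDeriv x * (Real.exp (r * x) - Real.exp (r * -x)) : ℝ) : ℂ) := by
    intro r
    have e : ∀ t : ℝ, ((oddThetaTailTrunc a b t : ℝ) : ℂ) * cexp (((r : ℂ) + 1 / 2 - 1 / 2) * (t : ℂ)) =
        ((oddThetaTailTrunc a b t * Real.exp (r * t) : ℝ) : ℂ) := fun t => by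
      push_cast
      ring_nf
    simp only [weilMellin, e]
    rw [integral_complex_ofReal, tailPolar_integral_trunc_mul ha.le hab (by fun_prop)]
  -- `R̂(1) = ϖ`, `R̂(0) = -ϖ`
  have h1 : weilMellin (fun t => ((oddThetaTailTrunc a b t : ℝ) : ℂ)) 1 =
      (oddThetaPolarWeightTrunc a b : ℂ) := by
    have e := hR (1 / 2)
    rw [show (((1 / 2 : ℝ) : ℂ) + 1 / 2 : ℂ) = 1 by push_cast; ring] at e
    rw [e, oddThetaPolarWeightTrunc]
    congr 1
    refine setIntegral_congr_fun measurableSet_Ioc fun x _ => ?_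
    rw [Real.sinh_eq]
    ring_nf
  have h0 : weilMellin (fun t => ((oddThetaTailTrunc a b t : ℝ) : ℂ)) 0 =
      -(oddThetaPolarWeightTrunc a b : ℂ) := by
    have e := hR (-(1 / 2))
    rw [show (((-(1 / 2) : ℝ) : ℂ) + 1 / 2 : ℂ) = 0 by push_cast; ring] at e
    rw [e, oddThetaPolarWeightTrunc, ← Complex.ofReal_neg, ← integral_neg]
    congr 1
    refine setIntegral_congr_fun measurableSet_Ioc fun x _ => ?_
    rw [Real.sinh_eq]
    ring_nf
  -- `ĝ(0) - ĝ(1) = -2 ∫ g sinh(t/2)`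
  have hg01 : weilMellin g 0 - weilMellin g 1 = -(2 * ∫ t, g t * (Real.sinh (t / 2) : ℂ)) := by
    unfold weilMellin
    rw [← integral_sub (integrable_weilIntegrand hg.1.continuous hg.2 0)
      (integrable_weilIntegrand hg.1.continuous hg.2 1), ← integral_const_mul, ← integral_neg]
    refine integral_congr_ae (Eventually.of_forall fun t => ?_)
    beta_reduce
    rw [Complex.ofReal_sinh, Complex.sinh]
    push_cast
    ring_nf
  unfold weilPolarTerm
  rw [hM 0, hM 1, h0, h1]
  linear_combination (oddThetaPolarWeightTrunc a b : ℂ) * hg01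

end Summit.RiemannHypothesis.RiemannHypothesis.Theorems.OddBartaFloor

end
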